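import Literature.Geometry.Kaehler.ComplexTorusCyclotomicAutomorphismFiniteOrderEndomorphisms
import Literature.Geometry.Kaehler.ComplexTorusEndomorphismAlgebraProduct
import HarnessLib

/-!
# The endomorphism algebra of a complex torus with an automorphism of characteristic polynomial `Φ_d` and primitive
# type is the CM field `ℚ(ζ_d)`; the `ζ_5`-surface is a SIMPLE abelian surface with `End_ℚ ≅ ℚ(ζ_5)`

Layer `Literature/Geometry/Kaehler`, namespace `Literature.Geometry.Kaehler.ComplexTorus`; lane `lit-hodgefound`
(Track 2 foundations library), Layer A2/A3 junction, row «A2-26(gd)» (self-proposed 2026-08-28, prover seat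
`lit-hodgefound-p10`, generation 31, FILE 12).  `(X, u) ≅ (ℂ^Φ/Φ(𝔞), ζ_d)` (FILE 1) with `Φ` primitive: the model is
simple with `End_ℚ = ι(K) ≅ K = ℚ(ζ_d)` (Shimura §5.1 Prop. 6, §8.2 Prop. 26; the tree's
`CMTypeLattice.nonempty_algEquiv_endAlgRat_of_isSimple`), and both simplicity and `End_ℚ` travel along the
isomorphism `X ≅ ℂ^Φ/Φ(𝔞)` (the tree's `IsIsomorphic.isSimple_iff`, `IsIsogenous.nonempty_endAlgRatEquiv`).  So:
* §1 **`isSimple_of_iso`**, **`nonempty_algEquiv_endAlgRat_of_iso`** (`ℚ(ζ_d) ≃ₐ[ℚ] End_ℚ(X)`),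
  `finrank_endAlgRat_of_iso` (`dim_ℚ End_ℚ(X) = [ℚ(ζ_d) : ℚ]`), `endAlgRat_comm_of_iso` (`End_ℚ(X)` is commutative)
  for `(X, u)` of primitive type;
* §2 `d = 5` (every type primitive, FILE 10): **`isSimple_of_orderOf_eq_five`** — A TWO-DIMENSIONAL COMPLEX TORUS WITH
  AN ENDOMORPHISM OF ORDER `5` IS A SIMPLE ABELIAN SURFACE (FILE 2: abelian variety) — **`nonempty_algEquiv_endAlgRat_of_orderOf_eq_five`**
  (`End_ℚ(X) ≅ ℚ(ζ_5)` for every `{5}`-cyclotomic `K`), `finrank_endAlgRat_of_orderOf_eq_five` (`= 4`),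
  `endAlgRat_comm_of_orderOf_eq_five`;
* §3 `d = 3`: `nonempty_algEquiv_endAlgRat_of_orderOf_eq_three` (an elliptic curve with an automorphism of order `3`
  has `End_ℚ ≅ ℚ(ζ_3)`: complex multiplication by `ℚ(√−3)`), `finrank_endAlgRat_of_orderOf_eq_three` (`= 2`).

Theorems only (no `def`, no instance, no named fact; net debt 0).

Sources.  G. Shimura, *Abelian Varieties with Complex Multiplication and Modular Functions* (1998), §5.1 Prop. 6,
p. 37 («`A` simple … `End_ℚ(A) = ι(F)`»), §6.2 Thm. 3, p. 42, §8.2 Prop. 26, p. 69; Ch. Birkenhake, H. Lange,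
*Complex Abelian Varieties*, 2nd ed. (2004), §13.3 — not held (acq-10211), locator as cited by this lane's earlier
rows; J. H. Silverman, *The Arithmetic of Elliptic Curves* (2009), III §9–§10 (CM elliptic curves with `j = 0`) as cited
by the tree's elliptic-curve files.

## References

* [Shimura1998] G. Shimura, *Abelian Varieties with Complex Multiplication and Modular Functions*, Princeton
  Univ. Press (1998), §5.1 Prop. 6 p. 37, §6.2 Thm. 3 p. 42, §8.2 Prop. 26 p. 69.
* [BirkenhakeLange2004] Ch. Birkenhake, H. Lange, *Complex Abelian Varieties*, 2nd ed., Grundlehren 302 (2004), §13.3.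
* [SilvermanAEC2009] J. H. Silverman, *The Arithmetic of Elliptic Curves*, 2nd ed., GTM 106 (2009), III §10 Thm. 10.1.
-/

noncomputable section

open scoped Classical nonZeroDivisors NumberField Manifold ContDiff
open NumberField Module Polynomial

namespace Literature.Geometry.Kaehler

namespace ComplexTorus

open Literature.AlgebraicGeometry.Motives (CMType)
open Literature.NumberTheory.ComplexMultiplication.CMTypeLattice (periodIso nonempty_algEquiv_endAlgRat_of_isSimple
  finrank_endAlgRat_of_isSimple endAlgRat_comm_of_isSimple)
-- `CMTypeLattice.mulMatrix I a` (multiplication by `a ∈ 𝓞 K` on the ideal `I`) is spelled with its namespace below: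
-- the elliptic-curve files in the import cone declare a `ComplexTorus.mulMatrix` of their own.
open Literature.NumberTheory.ComplexMultiplication (CMTypeLattice.mulMatrix)

/-! ### §1 Primitive type: `X` is simple and `End_ℚ(X) ≅ ℚ(ζ_d)` -/

section General

variable {ι : Type} [Fintype ι] [DecidableEq ι] {E : Type} [NormedAddCommGroup E] [NormedSpace ℂ E]
  {P : (ι → ℝ) ≃L[ℝ] E} {K : Type} [Field K] [NumberField K]

/-- **`X ≅ ℂ^Φ/Φ(𝔞)` with the model simple (`Φ` primitive) ⟹ `X` is simple.** [cite: Shimura1998, §8.2 Prop. 26, p. 69] -/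
theorem isSimple_of_iso {Φ : CMType K} {I : (FractionalIdeal (𝓞 K)⁰ K)ˣ}
    (hS : ComplexTorus.IsSimple (periodIso Φ I)) (e : ComplexTorus P ≃+ ComplexTorus (periodIso Φ I))
    (he : ContMDiff 𝓘(ℂ, E) 𝓘(ℂ, Φ.1 → ℂ) ω e) (he₂ : ContMDiff 𝓘(ℂ, Φ.1 → ℂ) 𝓘(ℂ, E) ω e.symm) :
    ComplexTorus.IsSimple P :=
  (IsIsomorphic.isSimple_iff ⟨e, he, he₂⟩).2 hS

/-- **`End_ℚ(X) ≅ K = ℚ(ζ_d)`** for `X ≅ ℂ^Φ/Φ(𝔞)` with the model simple: `End_ℚ` of the model is `ι(K) ≅ K`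
(«`End_ℚ(A)` coincides with `ι(F)`») and `End_ℚ` is an isomorphism (indeed isogeny) invariant.
[cite: Shimura1998, §5.1 Prop. 6, p. 37] [cite: BirkenhakeLange2004, §13.3] -/
theorem nonempty_algEquiv_endAlgRat_of_iso {Φ : CMType K} {I : (FractionalIdeal (𝓞 K)⁰ K)ˣ}
    (hS : ComplexTorus.IsSimple (periodIso Φ I)) (e : ComplexTorus P ≃+ ComplexTorus (periodIso Φ I))
    (he : ContMDiff 𝓘(ℂ, E) 𝓘(ℂ, Φ.1 → ℂ) ω e) (he₂ : ContMDiff 𝓘(ℂ, Φ.1 → ℂ) 𝓘(ℂ, E) ω e.symm) :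
    Nonempty (K ≃ₐ[ℚ] endAlgRat P) := by
  obtain ⟨f⟩ := nonempty_algEquiv_endAlgRat_of_isSimple Φ I hS
  obtain ⟨g⟩ := (IsIsomorphic.isIsogenous ⟨e, he, he₂⟩).symm.nonempty_endAlgRatEquiv
  exact ⟨f.trans g⟩

/-- **`dim_ℚ End_ℚ(X) = [K : ℚ]`** for `X ≅ ℂ^Φ/Φ(𝔞)` with the model simple. [cite: Shimura1998, §5.1 Prop. 6, p. 37] -/
theorem finrank_endAlgRat_of_iso {Φ : CMType K} {I : (FractionalIdeal (𝓞 K)⁰ K)ˣ}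
    (hS : ComplexTorus.IsSimple (periodIso Φ I)) (e : ComplexTorus P ≃+ ComplexTorus (periodIso Φ I))
    (he : ContMDiff 𝓘(ℂ, E) 𝓘(ℂ, Φ.1 → ℂ) ω e) (he₂ : ContMDiff 𝓘(ℂ, Φ.1 → ℂ) 𝓘(ℂ, E) ω e.symm) :
    finrank ℚ (endAlgRat P) = finrank ℚ K := by
  obtain ⟨f⟩ := nonempty_algEquiv_endAlgRat_of_iso hS e he he₂
  exact f.toLinearEquiv.finrank_eq.symm

/-- **`End_ℚ(X)` is commutative** for `X ≅ ℂ^Φ/Φ(𝔞)` with the model simple (it is a field `≅ K`).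
[cite: Shimura1998, §5.1 Prop. 6, p. 37] -/
theorem endAlgRat_comm_of_iso {Φ : CMType K} {I : (FractionalIdeal (𝓞 K)⁰ K)ˣ}
    (hS : ComplexTorus.IsSimple (periodIso Φ I)) (e : ComplexTorus P ≃+ ComplexTorus (periodIso Φ I))
    (he : ContMDiff 𝓘(ℂ, E) 𝓘(ℂ, Φ.1 → ℂ) ω e) (he₂ : ContMDiff 𝓘(ℂ, Φ.1 → ℂ) 𝓘(ℂ, E) ω e.symm)
    (a c : endAlgRat P) : a * c = c * a := by
  obtain ⟨f⟩ := nonempty_algEquiv_endAlgRat_of_iso (P := P) hS e he he₂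
  apply f.symm.injective
  rw [map_mul, map_mul, mul_comm]

end General

/-! ### §2 `d = 5`: the `ζ_5`-surface is a simple abelian surface with `End_ℚ ≅ ℚ(ζ_5)` -/

section Five

variable {ι : Type} [Fintype ι] [DecidableEq ι] {E : Type} [NormedAddCommGroup E] [NormedSpace ℂ E]
  {P : (ι → ℝ) ≃L[ℝ] E}

/-- **`End_ℚ(X) ≅ ℚ(ζ_5)`**: a `2`-dimensional complex torus `X` with an endomorphism of order `5` has endomorphism
algebra isomorphic to (any) `{5}`-cyclotomic field `K` (`(X, u) ≅ (ℂ²/Φ(𝓞_K), ζ_5)`, every CM type of `K` is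
primitive, FILES 2, 10). [cite: Shimura1998, §5.1 Prop. 6 p. 37, §8.4 (2) p. 73] [cite: BirkenhakeLange2004, §13.3] -/
theorem nonempty_algEquiv_endAlgRat_of_orderOf_eq_five {K : Type} [Field K] [NumberField K]
    [IsCyclotomicExtension {5} ℚ K] {A : Matrix ι ι ℤ} (hA : A ∈ endRingInt P) (hord : orderOf A = 5)
    (hdim : finrank ℂ E = 2) : Nonempty (K ≃ₐ[ℚ] endAlgRat P) := by
  obtain ⟨ζ, hζ⟩ : ∃ ζ : K, IsPrimitiveRoot ζ 5 :=
    IsCyclotomicExtension.exists_isPrimitiveRoot ℚ K (Set.mem_singleton 5) (by norm_num)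
  obtain ⟨Φ, e, he, he', -⟩ := exists_iso_periodIso_one_of_orderOf_eq_five hζ hA hord hdim
  exact nonempty_algEquiv_endAlgRat_of_iso (isSimple_periodIso_five Φ 1) e he he'

set_option backward.isDefEq.respectTransparency false in -- Mathlib's instance
-- `IsCyclotomicExtension {5} ℚ (CyclotomicField 5 ℚ)` is keyed on `CyclotomicField.algebra`, the goal on
-- `DivisionRing.toRatAlgebra` (same workaround as FILE 1 `isAbelianVariety_of_charpoly_eq_cyclotomic`)
/-- **A TWO-DIMENSIONAL COMPLEX TORUS WITH AN ENDOMORPHISM OF ORDER `5` IS SIMPLE** (an abelian surface — FILE 2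
`isAbelianVariety_of_orderOf_eq` — not isogenous to a product of elliptic curves: it is `ℂ²/Φ(𝓞_{ℚ(ζ_5)})` with `Φ`
primitive). [cite: Shimura1998, §8.2 Prop. 26 p. 69, §8.4 (2) p. 73] [cite: BirkenhakeLange2004, §13.3] -/
theorem isSimple_of_orderOf_eq_five {A : Matrix ι ι ℤ} (hA : A ∈ endRingInt P) (hord : orderOf A = 5)
    (hdim : finrank ℂ E = 2) : ComplexTorus.IsSimple P := by
  have hζ := IsCyclotomicExtension.zeta_spec 5 ℚ (CyclotomicField 5 ℚ)
  obtain ⟨Φ, e, he, he', -⟩ := exists_iso_periodIso_one_of_orderOf_eq_five hζ hA hord hdim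
  exact isSimple_of_iso (isSimple_periodIso_five Φ 1) e he he'

set_option backward.isDefEq.respectTransparency false in -- see above
/-- **`dim_ℚ End_ℚ(X) = 4`** for the `ζ_5`-surface. [cite: Shimura1998, §5.1 Prop. 6, p. 37] [cite: BirkenhakeLange2004, §13.3] -/
theorem finrank_endAlgRat_of_orderOf_eq_five {A : Matrix ι ι ℤ} (hA : A ∈ endRingInt P) (hord : orderOf A = 5)
    (hdim : finrank ℂ E = 2) : finrank ℚ (endAlgRat P) = 4 := by
  obtain ⟨f⟩ := nonempty_algEquiv_endAlgRat_of_orderOf_eq_five (K := CyclotomicField 5 ℚ) hA hord hdim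
  rw [← f.toLinearEquiv.finrank_eq, IsCyclotomicExtension.finrank (n := 5) (CyclotomicField 5 ℚ)
    (cyclotomic.irreducible_rat (by norm_num)), Nat.totient_prime Nat.prime_five]

set_option backward.isDefEq.respectTransparency false in -- see above
/-- **`End_ℚ(X)` is commutative** for the `ζ_5`-surface (a field, `ℚ(ζ_5)`). [cite: Shimura1998, §5.1 Prop. 6, p. 37] -/
theorem endAlgRat_comm_of_orderOf_eq_five {A : Matrix ι ι ℤ} (hA : A ∈ endRingInt P) (hord : orderOf A = 5)
    (hdim : finrank ℂ E = 2) (a c : endAlgRat P) : a * c = c * a := by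
  obtain ⟨f⟩ := nonempty_algEquiv_endAlgRat_of_orderOf_eq_five (K := CyclotomicField 5 ℚ) hA hord hdim
  apply f.symm.injective
  rw [map_mul, map_mul, mul_comm]

end Five

/-! ### §3 `d = 3`: the elliptic curve with an automorphism of order `3` has `End_ℚ ≅ ℚ(ζ_3)` -/

section Three

variable {ι : Type} [Fintype ι] [DecidableEq ι] {E : Type} [NormedAddCommGroup E] [NormedSpace ℂ E]
  {P : (ι → ℝ) ≃L[ℝ] E}

/-- **`End_ℚ(X) ≅ ℚ(ζ_3)`** for a one-dimensional complex torus with an endomorphism of order `3` (complex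
multiplication by `ℚ(√−3)`; `K` any `{3}`-cyclotomic field). [cite: SilvermanAEC2009, III §10 Thm. 10.1]
[cite: Shimura1998, §5.1 Prop. 6 p. 37, §8.4 (1) p. 65] -/
theorem nonempty_algEquiv_endAlgRat_of_orderOf_eq_three {K : Type} [Field K] [NumberField K]
    [IsCyclotomicExtension {3} ℚ K] {A : Matrix ι ι ℤ} (hA : A ∈ endRingInt P) (hord : orderOf A = 3)
    (hdim : finrank ℂ E = 1) : Nonempty (K ≃ₐ[ℚ] endAlgRat P) := by
  obtain ⟨ζ, hζ⟩ : ∃ ζ : K, IsPrimitiveRoot ζ 3 :=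
    IsCyclotomicExtension.exists_isPrimitiveRoot ℚ K (Set.mem_singleton 3) (by norm_num)
  have h2 : finrank ℚ K = 2 := by
    rw [IsCyclotomicExtension.finrank (n := 3) K (cyclotomic.irreducible_rat (by norm_num)),
      Nat.totient_prime Nat.prime_three]
  obtain ⟨Φ, e, he, he', -⟩ := exists_iso_periodIso_one_of_orderOf_eq_three hζ hA hord hdim
  exact nonempty_algEquiv_endAlgRat_of_iso (isSimple_periodIso_of_finrank_eq_two h2 Φ 1) e he he'

set_option backward.isDefEq.respectTransparency false in -- see §2
/-- **`dim_ℚ End_ℚ(X) = 2`** for the `ζ_3`-curve (a CM elliptic curve). [cite: SilvermanAEC2009, III §10 Thm. 10.1]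
[cite: Shimura1998, §5.1 Prop. 6, p. 37] -/
theorem finrank_endAlgRat_of_orderOf_eq_three {A : Matrix ι ι ℤ} (hA : A ∈ endRingInt P) (hord : orderOf A = 3)
    (hdim : finrank ℂ E = 1) : finrank ℚ (endAlgRat P) = 2 := by
  obtain ⟨f⟩ := nonempty_algEquiv_endAlgRat_of_orderOf_eq_three (K := CyclotomicField 3 ℚ) hA hord hdim
  rw [← f.toLinearEquiv.finrank_eq, IsCyclotomicExtension.finrank (n := 3) (CyclotomicField 3 ℚ)
    (cyclotomic.irreducible_rat (by norm_num)), Nat.totient_prime Nat.prime_three]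

end Three

end ComplexTorus

end Literature.Geometry.Kaehler
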